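import Summits.BirchSwinnertonDyer.Rank1Residual.Additive.GordRatMainConjLowerBoundThree
import Summits.BirchSwinnertonDyer.Rank1Residual.Additive.GordRatMainConjLowerBoundOdd
import Summits.BirchSwinnertonDyer.Rank1Residual.Additive.PotMultRatMainConjLowerBound
import Summits.BirchSwinnertonDyer.Rank1Residual.Additive.PotMultRatMainConjLowerBoundOdd
import HarnessLib

/-!
# Census H-9 / n1011 Q6: the μ-CERTIFICATE record format — "index of the first `p`-adic unit
# coefficient of the Néron-normalised `ω^{(p−1)/2}`-branch of `L_p(E♭)`" — typed as predicates that
# ARE the kernel binder `hcert` (cell `b2b-bsdres`, census cell, seat `b2b-bsdres-census-ctyper1`,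
# gen 2; CELL-PLAN §3 H-9; register `cells/n1011/PREDICTIONS-Q6.md` sha16 `5fce769f8ef0b634`)

HONEST FRAMING (cell `b2b-bsdres`, run/shared/lean/b2b/bsd-rank1-residual/, verbatim in every
file): the goal of the cell is to DELETE the COMBINATION-SHAPED residual classes of the
Birch–Swinnerton-Dyer formula for ALL analytic-rank `≤ 1` elliptic curves over `ℚ` — "full BSD
formula for every rank `≤ 1` curve in class `C`" assembled STRICTLY from published theorems — so
that the rank-`≤ 1` remainder becomes exactly the CONSTRUCTION-SHAPED classes, which are TYPED
(missing-input `Prop`s), NOT attempted. This is not "finishing BSD". Census cell: research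
instrumentation; a Q6 certificate is CERTIFICATE-EVIDENCE (instrumentation tier), a finite
computation reported by two engines, NEVER a Literature fact and never a kernel theorem except on
the unit rows (`n₀ = 0`, below); labels / RESIDUAL-MAP marks UNCHANGED; nothing booked. Definitions
(predicates, nothing asserted) + theorems; no named fact.

## The record (PREDICTIONS-Q6.md §1, §5; gate G-2 Stage A countersigned 2026-08-21T06:08Z)

Objects (§1): `E` additive at `p` on the semistable-twist locus, `E♭` the globally minimal twist by
`p* = ±p` (GOOD ORDINARY: locus GordTwo-ord; MULTIPLICATIVE: locus M), `f = f_{E♭}`,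
`i = (p−1)/2`, the Néron-normalised branch `ϖ · L_p(f, α♭ | a_p, ω^i, T)` (`ϖ·Ω^±_{E♭} = Ω^±_f`; sign
space `(−1)^i`), `c_n` its coefficients, `n₀(E,p) := min {n : ‖c_n‖_p = 1}`. PASS(E,p) (§5) := P0
(`v₀ = v(E)`, theorem-backed) ∧ both engines return the same `n₀ ≤ n_max` with `c_{n₀}` a certified
unit. A PASSed row is recorded here as the hypothesis instance `…FirstUnitIndexAt W p n₀` of the
matching locus/parity (four shapes below: Gord/M × even/odd) — `μ = 0 ∧ λ_an = n₀` of the branch —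
which implies p06's binder `hcert` (`…UnitCoeffCert`), hence the kernel consumers
(`ClassX4Gord.cycLowerLeadingTermAt_of_ratCharEq[Odd]_of_unitCoeff`, `…missingLowerBoundAt…`,
`ClassX4M.…Mult[Odd]…`; at `p = 3` the binder-free Gord3 end p252109). EVIDENCE FILE FORMAT (one TSV
row per (label, p)): `label, p, locus ∈ {GordTwo-ord, M}, i, sign, Eflat_label, a_p(E♭) | α♭ mod p^M,
v(E), v0_engineA, v0_engineB, n0_engineA, n0_engineB, c_{n0} mod p^M (both), n_max, M, gamma,
job ids, register sha16` → instance `GordFirstUnitIndexAt W p n0` (resp. `GordOdd…`, `Mult…`,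
`MultOdd…`) iff PASS; NOT-CERTIFIED rows get NO instance (anomaly protocol §7), never `μ > 0`.
UNIT ROWS (`v(E) = 0`): `n₀ = 0` is a THEOREM (§2 below, from census-ctyper-1's p250315
`CensusX41.norm_coeff_zero_even/_odd`: `‖c_0‖ = ‖L(E,1)/Ω_E‖_p` up to the unit `α♭⁻¹`/`c_∞`), so the
40-row calibration sample needs no instance.

Contents: §0 the four binder predicates (`GordBranchUnitCoeffCert`, `GordOddBranchUnitCoeffCert` —
the (M) twins `MultBranchUnitCoeffCert`, `MultOddBranchUnitCoeffCert` are p06's, reused) and the four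
first-unit-index records; §1 record ⟹ binder; §2 unit rows: `n₀ = 0` proved (Gord even/odd); §3 the
kernel consumers restated on the records (Gord even `p ≥ 5`, Gord odd `p = 3`, (M) even/odd).

References: Mazur–Tate–Teitelbaum, Invent. Math. 84 (1986) §I.10, §I.13–14
[MazurTateTeitelbaum1986Invent]; A. Pal, *The Manin constant …* (2012) Thm. 3.2 [Pal2012];
D. Delbourgo, Compos. Math. 2002, Thm. (A)/(B) [Delbourgo2002]; register PREDICTIONS-Q6.md (n1011-p06)
§1–§9; CELL-PLAN §3 H-9.
-/

noncomputable section

open scoped Classical MatrixGroups ModularForm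

open CongruenceSubgroup WeierstrassCurve Literature.NumberTheory.EllipticCurves
  Literature.NumberTheory.EllipticCurves.ModularForms
  Literature.NumberTheory.EllipticCurves.Rank1Residual
  Literature.NumberTheory.EllipticCurves.Rank1Residual.Typed

namespace Summit.BirchSwinnertonDyer.Rank1Residual.Additive

namespace CensusQ6

/-! ### §0 The binders and the first-unit-index records (predicates; nothing asserted) -/

/-- p06's binder `hcert`, locus GordTwo-ord, `p ≡ 1 (mod 4)` (even branch): for every good-ordinary
twist model `V` (`C • V^{(p)} = W`), newform `f`, `ϖ·Ω_V = Ω⁺_f`, SOME coefficient of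
`ϖ · L_p(f, α♭, ω^{(p−1)/2}, T)` is a `p`-adic unit. [cite: MazurTateTeitelbaum1986Invent, §I.13] -/
abbrev GordBranchUnitCoeffCert (W : WeierstrassCurve ℚ) (p : ℕ) [Fact p.Prime] : Prop :=
  ∀ (V : WeierstrassCurve ℚ) [V.IsElliptic] [V.IsGloballyMinimal] (C : VariableChange ℚ),
    GoodOrd V p → C • V.quadraticTwist (p : ℚ) = W →
    ∀ {N : ℕ} [NeZero N] (f : CuspForm (Gamma0 N) 2), IsNewformOf V f →
    ∀ ϖ : ℚ, (ϖ : ℝ) * V.realPeriodRat = plusPeriod f →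
    ∃ n : ℕ, ‖PowerSeries.coeff n
      (PowerSeries.C (ϖ : ℚ_[p]) * padicLFunctionBranch f (unitRoot V p : ℚ_[p]) (p / 2))‖ = 1

/-- p06's binder `hcert`, locus GordTwo-ord, `p ≡ 3 (mod 4)` (odd branch, twist by `−p`, `Ω⁻`).
[cite: MazurTateTeitelbaum1986Invent, §I.13] -/
abbrev GordOddBranchUnitCoeffCert (W : WeierstrassCurve ℚ) (p : ℕ) [Fact p.Prime] : Prop :=
  ∀ (V : WeierstrassCurve ℚ) [V.IsElliptic] [V.IsGloballyMinimal] (C : VariableChange ℚ),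
    GoodOrd V p → C • V.quadraticTwist (-(p : ℚ)) = W →
    ∀ {N : ℕ} [NeZero N] (f : CuspForm (Gamma0 N) 2), IsNewformOf V f →
    ∀ ϖ : ℚ, (ϖ : ℝ) * V.imaginaryPeriodRat = minusPeriod f →
    ∃ n : ℕ, ‖PowerSeries.coeff n
      (PowerSeries.C (ϖ : ℚ_[p]) * padicLFunctionMinusBranch f (unitRoot V p : ℚ_[p]) (p / 2))‖ = 1

/-- **Q6 record, GordTwo-ord, even branch: the first unit coefficient has index `n₀`** (`c_m ∈ pℤ_p`
for `m < n₀`, `c_{n₀} ∈ ℤ_p^×`; i.e. `μ = 0`, `λ_an = n₀` for the Néron-normalised branch) — the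
PASS(E,p) row of PREDICTIONS-Q6 §5 as a hypothesis instance. [cite: MazurTateTeitelbaum1986Invent, §I.13] -/
def GordFirstUnitIndexAt (W : WeierstrassCurve ℚ) (p : ℕ) [Fact p.Prime] (n₀ : ℕ) : Prop :=
  ∀ (V : WeierstrassCurve ℚ) [V.IsElliptic] [V.IsGloballyMinimal] (C : VariableChange ℚ),
    GoodOrd V p → C • V.quadraticTwist (p : ℚ) = W →
    ∀ {N : ℕ} [NeZero N] (f : CuspForm (Gamma0 N) 2), IsNewformOf V f →
    ∀ ϖ : ℚ, (ϖ : ℝ) * V.realPeriodRat = plusPeriod f →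
    (∀ m < n₀, ‖PowerSeries.coeff m
      (PowerSeries.C (ϖ : ℚ_[p]) * padicLFunctionBranch f (unitRoot V p : ℚ_[p]) (p / 2))‖ < 1) ∧
    ‖PowerSeries.coeff n₀
      (PowerSeries.C (ϖ : ℚ_[p]) * padicLFunctionBranch f (unitRoot V p : ℚ_[p]) (p / 2))‖ = 1

/-- **Q6 record, GordTwo-ord, odd branch** (twist by `−p`, `Ω⁻`, `L_p^−`). [cite: MazurTateTeitelbaum1986Invent, §I.13] -/
def GordOddFirstUnitIndexAt (W : WeierstrassCurve ℚ) (p : ℕ) [Fact p.Prime] (n₀ : ℕ) : Prop :=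
  ∀ (V : WeierstrassCurve ℚ) [V.IsElliptic] [V.IsGloballyMinimal] (C : VariableChange ℚ),
    GoodOrd V p → C • V.quadraticTwist (-(p : ℚ)) = W →
    ∀ {N : ℕ} [NeZero N] (f : CuspForm (Gamma0 N) 2), IsNewformOf V f →
    ∀ ϖ : ℚ, (ϖ : ℝ) * V.imaginaryPeriodRat = minusPeriod f →
    (∀ m < n₀, ‖PowerSeries.coeff m
      (PowerSeries.C (ϖ : ℚ_[p]) * padicLFunctionMinusBranch f (unitRoot V p : ℚ_[p]) (p / 2))‖ <
        1) ∧
    ‖PowerSeries.coeff n₀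
      (PowerSeries.C (ϖ : ℚ_[p]) * padicLFunctionMinusBranch f (unitRoot V p : ℚ_[p]) (p / 2))‖ = 1

/-- **Q6 record, locus M, even branch** (`a_p(E♭) = ap = ±1`, `L_p^+` of the multiplicative twist).
[cite: MazurTateTeitelbaum1986Invent, §I.13] -/
def MultFirstUnitIndexAt (W : WeierstrassCurve ℚ) (p : ℕ) [Fact p.Prime] (n₀ : ℕ) : Prop :=
  ∀ (V : WeierstrassCurve ℚ) [V.IsElliptic] [V.IsGloballyMinimal] (C : VariableChange ℚ),
    Mult V p → C • V.quadraticTwist (p : ℚ) = W →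
    ∀ {N : ℕ} [NeZero N] (f : CuspForm (Gamma0 N) 2), IsNewformOf V f → ∀ (ap : ℤ), cuspCoeff f p = ap →
    ∀ ϖ : ℚ, (ϖ : ℝ) * V.realPeriodRat = plusPeriod f →
    (∀ m < n₀, ‖PowerSeries.coeff m
      (PowerSeries.C (ϖ : ℚ_[p]) * padicLFunctionPlusBranchMult f (ap : ℚ_[p]) (p / 2))‖ < 1) ∧
    ‖PowerSeries.coeff n₀
      (PowerSeries.C (ϖ : ℚ_[p]) * padicLFunctionPlusBranchMult f (ap : ℚ_[p]) (p / 2))‖ = 1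

/-- **Q6 record, locus M, odd branch** (twist by `−p`, `Ω⁻`, `L_p^−` of the multiplicative twist).
[cite: MazurTateTeitelbaum1986Invent, §I.13] -/
def MultOddFirstUnitIndexAt (W : WeierstrassCurve ℚ) (p : ℕ) [Fact p.Prime] (n₀ : ℕ) : Prop :=
  ∀ (V : WeierstrassCurve ℚ) [V.IsElliptic] [V.IsGloballyMinimal] (C : VariableChange ℚ),
    Mult V p → C • V.quadraticTwist (-(p : ℚ)) = W →
    ∀ {N : ℕ} [NeZero N] (f : CuspForm (Gamma0 N) 2), IsNewformOf V f → ∀ (ap : ℤ), cuspCoeff f p = ap →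
    ∀ ϖ : ℚ, (ϖ : ℝ) * V.imaginaryPeriodRat = minusPeriod f →
    (∀ m < n₀, ‖PowerSeries.coeff m
      (PowerSeries.C (ϖ : ℚ_[p]) * padicLFunctionMinusBranchMult f (ap : ℚ_[p]) (p / 2))‖ < 1) ∧
    ‖PowerSeries.coeff n₀
      (PowerSeries.C (ϖ : ℚ_[p]) * padicLFunctionMinusBranchMult f (ap : ℚ_[p]) (p / 2))‖ = 1

variable {W : WeierstrassCurve ℚ} {p : ℕ} [hp : Fact p.Prime]

/-! ### §1 A record gives the binder -/

/-- Record ⟹ binder (Gord, even). -/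
theorem gordBranchUnitCoeffCert_of_firstUnitIndex {n₀ : ℕ} (h : GordFirstUnitIndexAt W p n₀) :
    GordBranchUnitCoeffCert W p :=
  fun V _ _ C hV hC _ _ f hf ϖ hϖ => ⟨n₀, (h V C hV hC f hf ϖ hϖ).2⟩

/-- Record ⟹ binder (Gord, odd). -/
theorem gordOddBranchUnitCoeffCert_of_firstUnitIndex {n₀ : ℕ}
    (h : GordOddFirstUnitIndexAt W p n₀) : GordOddBranchUnitCoeffCert W p :=
  fun V _ _ C hV hC _ _ f hf ϖ hϖ => ⟨n₀, (h V C hV hC f hf ϖ hϖ).2⟩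

/-- Record ⟹ binder (M, even; p06's `MultBranchUnitCoeffCert`). -/
theorem multBranchUnitCoeffCert_of_firstUnitIndex {n₀ : ℕ} (h : MultFirstUnitIndexAt W p n₀) :
    MultBranchUnitCoeffCert W p :=
  fun V _ _ C hV hC _ _ f hf ap hap ϖ hϖ => ⟨n₀, (h V C hV hC f hf ap hap ϖ hϖ).2⟩

/-- Record ⟹ binder (M, odd; p06's `MultOddBranchUnitCoeffCert`). -/
theorem multOddBranchUnitCoeffCert_of_firstUnitIndex {n₀ : ℕ}
    (h : MultOddFirstUnitIndexAt W p n₀) : MultOddBranchUnitCoeffCert W p :=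
  fun V _ _ C hV hC _ _ f hf ap hap ϖ hϖ => ⟨n₀, (h V C hV hC f hf ap hap ϖ hϖ).2⟩

/-! ### §2 Unit rows: `n₀ = 0` is a theorem (the 40-row calibration sample; P0) -/

omit hp in
/-- `‖r‖_p = 1` for a nonzero rational of `p`-adic valuation `0`. -/
private theorem norm_ratCast_eq_one [Fact p.Prime] {r : ℚ} (hr : r ≠ 0)
    (hv : padicValRat p r = 0) : ‖((r : ℚ) : ℚ_[p])‖ = 1 := by
  have hrQ : ((r : ℚ) : ℚ_[p]) ≠ 0 := by exact_mod_cast hr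
  rw [Padic.norm_eq_zpow_neg_valuation hrQ, Padic.valuation_ratCast, hv, neg_zero, zpow_zero]

/-- **Unit rows, even: `n₀ = 0`.** If `L(E,1) = q·Ω_E`, `q ≠ 0`, `ord_p q = 0`, then the record
`GordFirstUnitIndexAt W p 0` HOLDS (`‖c_0‖ = ‖ϖ S⁺‖_p = ‖q‖_p = 1`, census-ctyper-1 p250315).
[cite: MazurTateTeitelbaum1986Invent, §I.10 (10.1), §I.13] [cite: Pal2012, Thm. 3.2] -/
theorem gordFirstUnitIndexAt_zero_of_unitLValue (hmod : hasEntireLFunction_rat) (hp4 : p % 4 = 1)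
    [W.IsElliptic] [W.IsGloballyMinimal] (hadd : Addv W p)
    {q : ℚ} (hq : W.entireLFunction 1 = (q : ℂ) * (W.realPeriodRat : ℂ)) (hq0 : q ≠ 0)
    (hv : padicValRat p q = 0) : GordFirstUnitIndexAt W p 0 := by
  intro V _ _ C hV hC N _ f hf ϖ hϖ
  refine ⟨fun m hm => absurd hm (Nat.not_lt_zero m), ?_⟩
  have hord : IsOrdinaryAt V p := (isOrdinaryAt_iff V p).mpr ⟨hV.1, hV.2⟩
  obtain ⟨hnorm, hL⟩ := CensusX41.norm_coeff_zero_even p hmod hp4 V W C hC hord hadd hf ϖ hϖ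
  have hΩ : (W.realPeriodRat : ℂ) ≠ 0 := by exact_mod_cast W.realPeriodRat_pos_holds.ne'
  have hqS : ϖ * legendrePlusSymbolSum f p = q := by
    have h : ((ϖ * legendrePlusSymbolSum f p : ℚ) : ℂ) = (q : ℂ) :=
      mul_right_cancel₀ hΩ (hL.symm.trans hq)
    exact_mod_cast h
  rw [hnorm, hqS]
  exact norm_ratCast_eq_one hq0 hv

/-- **Unit rows, odd: `n₀ = 0`** (`‖c_0‖ = ‖ϖ⁻ S⁻‖_p = ‖c_∞ q‖_p = ‖q‖_p = 1`, `c_∞ ∈ {1,2}`, `p` odd).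
[cite: MazurTateTeitelbaum1986Invent, §I.10 (10.1), §I.13] [cite: Pal2012, Thm. 3.2] -/
theorem gordOddFirstUnitIndexAt_zero_of_unitLValue (hmod : hasEntireLFunction_rat)
    (hp4 : p % 4 = 3) [W.IsElliptic] [W.IsGloballyMinimal] (hadd : Addv W p)
    {q : ℚ} (hq : W.entireLFunction 1 = (q : ℂ) * (W.realPeriodRat : ℂ)) (hq0 : q ≠ 0)
    (hv : padicValRat p q = 0) : GordOddFirstUnitIndexAt W p 0 := by
  intro V _ _ C hV hC N _ f hf ϖ hϖ
  refine ⟨fun m hm => absurd hm (Nat.not_lt_zero m), ?_⟩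
  have hp2 : p ≠ 2 := by omega
  have hord : IsOrdinaryAt V p := (isOrdinaryAt_iff V p).mpr ⟨hV.1, hV.2⟩
  obtain ⟨hnorm, hL⟩ := CensusX41.norm_coeff_zero_odd p hmod hp4 V W C hC hord hadd hf ϖ hϖ
  set c : ℕ := (W.baseChange ℝ).numRealComponents with hc
  have hc12 : c = 1 ∨ c = 2 := by
    rw [hc, numRealComponents]
    split_ifs
    · exact Or.inr rfl
    · exact Or.inl rfl
  have hc0 : (c : ℚ) ≠ 0 := by rcases hc12 with h | h <;> rw [h] <;> norm_num
  have hcv : padicValRat p (c : ℚ) = 0 := by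
    rcases hc12 with h | h
    · rw [h, Nat.cast_one]; exact padicValRat.one
    · have h2 : padicValRat p ((2 : ℕ) : ℚ) = 0 := by
        rw [padicValRat.of_nat, Nat.cast_eq_zero]
        exact padicValNat_primes hp2
      rw [h]
      exact_mod_cast h2
  -- `ϖ⁻·S⁻ = c · q` since both sides over `c` are `L(E,1)/Ω_E`
  have hΩ : (W.realPeriodRat : ℂ) ≠ 0 := by exact_mod_cast W.realPeriodRat_pos_holds.ne'
  have hqS : ϖ * legendreMinusSymbolSum f p = c * q := by
    have h : ((ϖ * legendreMinusSymbolSum f p / (c : ℚ) : ℚ) : ℂ) = (q : ℂ) :=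
      mul_right_cancel₀ hΩ (hL.symm.trans hq)
    have h' : ϖ * legendreMinusSymbolSum f p / (c : ℚ) = q := by exact_mod_cast h
    rw [div_eq_iff hc0] at h'
    rw [h', mul_comm]
  rw [hnorm, hqS]
  exact norm_ratCast_eq_one (mul_ne_zero hc0 hq0) (by rw [padicValRat.mul hc0 hq0, hcv, hv, add_zero])

/-! ### §3 The kernel consumers on the records -/

/-- **Gord, even, `p ≥ 5`, `r_an = 0`, non-anomalous: record ⟹ `MissingLowerBoundAt W p`** (p06's
`ClassX4Gord.missingLowerBoundAt_rankZero_of_ratCharEq_of_unitCoeff` with `hcert :=` the record).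
[cite: Delbourgo2002, Theorem (A), (B)] [cite: MazurTateTeitelbaum1986Invent, §I.14] -/
theorem ClassX4Gord.missingLowerBoundAt_rankZero_of_ratCharEq_of_firstUnitIndex
    [W.IsElliptic] [W.IsGloballyMinimal] (hDel : Delbourgo2002.mainTheorem)
    (hPal : Pal2012.thm32_sqrt_mul_realPeriodRat_twist_eq_of_prime_one_mod_four)
    (hGZK : rank_eq_analyticRank_of_analyticRank_le_one) (hmod : hasEntireLFunction_rat)
    (hmodD : nonempty_modularParametrizationData)
    (hX : ClassX4Gord W p) (he : semistabilityIndex W p = 2) (hp5 : 5 ≤ p) (hp4 : p % 4 = 1)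
    (hcm : ¬ W.HasCM) (hr : W.analyticRank = 0) (hna : Delbourgo2002.ReductionNonAnomalous W p)
    (hMC : ChiBranchRatCharEqAt W p) {n₀ : ℕ} (hrec : GordFirstUnitIndexAt W p n₀) :
    MissingLowerBoundAt W p :=
  ClassX4Gord.missingLowerBoundAt_rankZero_of_ratCharEq_of_unitCoeff hDel hPal hGZK hmod hmodD hX he
    hp5 hp4 hcm hr hna hMC (gordBranchUnitCoeffCert_of_firstUnitIndex hrec)

/-- **Gord, odd, `p = 3`, `r_an = 0`, non-CM, non-anomalous: record ⟹ `MissingLowerBoundAt W 3`**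
(p06's binder-free Gord3 end p252109 `…three_rankZero_of_ratCharEqOdd_of_unitCoeff`).
[cite: Delbourgo2002, Theorem (A), (B) (p. 40)] [cite: MazurTateTeitelbaum1986Invent, §I.14] -/
theorem ClassX4Gord.missingLowerBoundAt_three_rankZero_of_ratCharEqOdd_of_firstUnitIndex
    [W.IsElliptic] [W.IsGloballyMinimal] [Fact (Nat.Prime 3)]
    (hDel3 : Delbourgo2002.mainTheorem_three)
    (hGZK : rank_eq_analyticRank_of_analyticRank_le_one) (hmod : hasEntireLFunction_rat)
    (hmodD : nonempty_modularParametrizationData)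
    (hX : ClassX4Gord W 3) (hcm : ¬ W.HasCM) (hr : W.analyticRank = 0)
    (hna : Delbourgo2002.ReductionNonAnomalous W 3) (hMC : ChiBranchRatCharEqOddAt W 3)
    {n₀ : ℕ} (hrec : GordOddFirstUnitIndexAt W 3 n₀) : MissingLowerBoundAt W 3 :=
  ClassX4Gord.missingLowerBoundAt_three_rankZero_of_ratCharEqOdd_of_unitCoeff hDel3 hGZK hmod hmodD
    hX hcm hr hna hMC (fun V _ _ C hV hC _ _ f hf ϖ hϖ =>
      gordOddBranchUnitCoeffCert_of_firstUnitIndex hrec V C hV (by exact_mod_cast hC) f hf ϖ hϖ)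

/-- **Gord, odd, general `p ≡ 3 (mod 4)`: record ⟹ `CycLowerLeadingTermAt W p`** (p06's
`ClassX4Gord.cycLowerLeadingTermAt_of_ratCharEqOdd_of_unitCoeff`).
[cite: MazurTateTeitelbaum1986Invent, §I.14] [cite: Pal2012, Thm. 3.2] -/
theorem ClassX4Gord.cycLowerLeadingTermAt_of_ratCharEqOdd_of_firstUnitIndex
    [W.IsElliptic] [W.IsGloballyMinimal]
    (hmod : hasEntireLFunction_rat) (hmodD : nonempty_modularParametrizationData)
    (hX : ClassX4Gord W p) (he : semistabilityIndex W p = 2) (hp4 : p % 4 = 3)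
    (hMC : ChiBranchRatCharEqOddAt W p) {n₀ : ℕ} (hrec : GordOddFirstUnitIndexAt W p n₀) :
    CycLowerLeadingTermAt W p :=
  ClassX4Gord.cycLowerLeadingTermAt_of_ratCharEqOdd_of_unitCoeff hmod hmodD hX he hp4 hMC
    (gordOddBranchUnitCoeffCert_of_firstUnitIndex hrec)

/-- **(M), even: record ⟹ `CycLowerLeadingTermAt W p`** (p06's `ClassX4M.…Mult_of_unitCoeff`).
[cite: MazurTateTeitelbaum1986Invent, §I.14] [cite: Pal2012, Thm. 3.2] -/
theorem ClassX4M.cycLowerLeadingTermAt_of_ratCharEqMult_of_firstUnitIndex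
    [W.IsElliptic] [W.IsGloballyMinimal]
    (hPal : Pal2012.thm32_sqrt_mul_realPeriodRat_twist_eq_of_prime_one_mod_four)
    (hmod : hasEntireLFunction_rat) (hmodD : nonempty_modularParametrizationData)
    (hX : AdditivePotMult.ClassX4M W p) (hp4 : p % 4 = 1) (hMC : ChiBranchRatCharEqMultAt W p)
    {n₀ : ℕ} (hrec : MultFirstUnitIndexAt W p n₀) : CycLowerLeadingTermAt W p :=
  AdditivePotMult.ClassX4M.cycLowerLeadingTermAt_of_ratCharEqMult_of_unitCoeff hPal hmod hmodD hX hp4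
    hMC (multBranchUnitCoeffCert_of_firstUnitIndex hrec)

end CensusQ6

end Summit.BirchSwinnertonDyer.Rank1Residual.Additive

end
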